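import Literature.AnabelianGeometry.EtaleTheta.KummerMap
import Literature.AnabelianGeometry.EtaleTheta.KummerMapFunctoriality
import Literature.AnabelianGeometry.EtaleTheta.KummerKernel
import HarnessLib

/-!
# The Kummer map into `lim_{→ H} H¹(H, Λ(M))`: exactness of the direct limit and the kernel of `κ` (LANA §6.1)

Proof-only companion (theorems, no new definitions) of `KummerMap.lean` / `KummerKernel.lean` (abc-iut cell,
layer L2 vocabulary; filed by seat abc-iut-c312-4 for the L-LANA Kummer tower, in agreement with the owner
abc-iut-L2-t3's `KummerMap.lean`: "Not here: …"). Source: LANA Project interim report [LANA2026Report], §6.1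
pp. 31–32: the inductive system "`H` var[ies] over an inductive system of (open) subgroups of `G` (with respect
to inclusion)" of the groups `H¹(H, Λ(M))` with restriction maps, and `κ : M → lim_{→ H} H¹(H, Λ(M))`; the one
property of Kummer maps the anabelian sources USE is injectivity ([AbsTopIII] Def. 1.5 "Kummer-faithful",
cf. `KummerKernel.lean`). PROVED here:

* `resH1_self`, `resH1_trans` — the restriction maps `H¹(H, Λ) → H¹(H', Λ)` (`resH1`) form a functor
  (`res^H_H = id`, `res^{H'}_{H''} ∘ res^H_{H'} = res^H_{H''}`), whence `directedSystem_H1System`: the system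
  `i ↦ H¹(S i, Λ(A))` of `KummerMap.lean` is a `DirectedSystem` (so Mathlib's exactness of the direct limit,
  `AddCommGroup.DirectLimit.of.zero_exact`, applies);
* `kummerMap_eq_zero_iff` — **the kernel of `κ`**: `κ(a) = 0` in `lim_{→} H¹(S i, Λ(A))` iff at SOME level
  `S i` fixing `a`, `a` admits a compatible system of `S i`-invariant roots (level-wise criterion
  `kummerClass_eq_zero_iff` of `KummerKernel.lean` + exactness);
* `kummerMapHom_injective_of` — hence `κ` is injective as soon as, at every level, "an element of `A^{S i}` with
  `n`-th roots in `A^{S i}` for all `n ≥ 1` is trivial" (`⋂_n (A^{S i})^n = 1`, [AbsTopIII] Def. 1.5 (a) at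
  every level; for `A = K̄^×` over a local field: `⋂_n (E^×)^n = 1` for every finite `E/K`).

[cite: LANA2026Report, §6.1 pp. 31–32] Universe `Type` (Mathlib `groupCohomology`), as in `KummerMap.lean`.
-/

noncomputable section

namespace Literature.AnabelianGeometry.EtaleTheta

open groupCohomology CategoryTheory

/-! ## 1. The restriction maps form a functor -/

section Restriction

variable {G : Type} [Group G] {A : Type} [CommGroup A] [MulDistribMulAction G A]

/-- `res^H_H = id` on `H¹(H, Λ(A))`: the `H¹`-map of the identity co-morphism at `H' = H` is the identity
(checked on cocycles). [cite: LANA2026Report, §6.1 p.31] -/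
theorem resH1_self (H : Subgroup G) (x : H1 (cyclotomeRep (A := A) H)) : resH1 (le_refl H) x = x := by
  refine H1_induction_on x fun y => ?_
  change ((CoMorphism.refl G A).H1Map (CoMorphism.refl_cond (le_refl H))) (H1π _ y) = H1π _ y
  rw [H1π_comp_map_apply]
  congr 1

/-- `res^{H₂}_{H₃} ∘ res^{H₁}_{H₂} = res^{H₁}_{H₃}` for `H₃ ≤ H₂ ≤ H₁` (an instance of the compatibility
`H1Map_resH1` of `KummerMapFunctoriality.lean` for the identity co-morphism). [cite: LANA2026Report, §6.1 p.31] -/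
theorem resH1_trans {H₁ H₂ H₃ : Subgroup G} (h₁₂ : H₂ ≤ H₁) (h₂₃ : H₃ ≤ H₂)
    (x : H1 (cyclotomeRep (A := A) H₁)) :
    resH1 h₂₃ (resH1 h₁₂ x) = resH1 (h₂₃.trans h₁₂) x :=
  (CoMorphism.refl G A).H1Map_resH1 h₁₂ (CoMorphism.refl_cond h₂₃) (CoMorphism.refl_cond (h₂₃.trans h₁₂)) x

variable {ι : Type} [Preorder ι] (S : ι → Subgroup G) (hS : ∀ ⦃i j : ι⦄, i ≤ j → S j ≤ S i)

/-- **The inductive system `i ↦ H¹(S i, Λ(A))` is a directed system** (identity and composition of the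
restriction maps), so that Mathlib's exactness of `AddCommGroup.DirectLimit` applies to
`lim_{→ i} H¹(S i, Λ(A))`. [cite: LANA2026Report, §6.1 p.31] -/
theorem directedSystem_H1System :
    DirectedSystem (fun i => H1 (cyclotomeRep (A := A) (S i))) (fun i j h => H1System (A := A) S hS i j h) where
  map_self := fun ⦃i⦄ x => resH1_self (S i) x
  map_map := fun ⦃_ _ _⦄ hij hjk x => resH1_trans (hS hij) (hS hjk) x

end Restriction

/-! ## 2. The kernel of `κ : A → lim_{→} H¹(S i, Λ(A))` -/

section Kernel

variable {G : Type} [Group G] {A : Type} [CommGroup A] [MulDistribMulAction G A]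
  {ι : Type} [Preorder ι] [DecidableEq ι] [IsDirectedOrder ι] (S : ι → Subgroup G)
  (hS : ∀ ⦃i j : ι⦄, i ≤ j → S j ≤ S i) [RootableBy A ℕ]

/-- **Kernel of the Kummer map into the colimit**: `κ(a) = 0` iff at some level `S i` fixing `a` the element
`a` admits a compatible system of `S i`-INVARIANT roots (`RootSystem.IsInvariant`). (⇒): exactness of the
direct limit moves the vanishing to a finite level, where it is `kummerClass_eq_zero_iff`; (⇐): compute `κ(a)`
at that level. [cite: LANA2026Report, §6.1 pp. 31–32] -/
theorem kummerMap_eq_zero_iff (hc : IsExhausted A S) (a : A) :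
    kummerMap hS hc a = 0 ↔
      ∃ (i : ι) (_ : a ∈ invariants (A := A) (S i)), ∃ y : RootSystem a, y.IsInvariant (S i) := by
  haveI := directedSystem_H1System (A := A) S hS
  constructor
  · intro h0
    obtain ⟨i, hi⟩ := hc a
    rw [kummerMap_eq_of hS hc a i hi] at h0
    obtain ⟨j, hij, hj⟩ := AddCommGroup.DirectLimit.of.zero_exact
      (f := H1System (A := A) S hS) i (kummerClass (S i) ⟨a, hi⟩) h0
    have hj' : a ∈ invariants (A := A) (S j) := fun γ => hi ⟨γ, hS hij γ.2⟩
    have hzero : kummerClass (S j) ⟨a, hj'⟩ = 0 := by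
      rw [← resH1_kummerClass (hS hij) a hi hj']
      exact hj
    exact ⟨j, hj', (kummerClass_eq_zero_iff (S j) ⟨a, hj'⟩).mp hzero⟩
  · rintro ⟨i, hi, y, hy⟩
    rw [kummerMap_eq_of hS hc a i hi, (kummerClass_eq_zero_iff (S i) ⟨a, hi⟩).mpr ⟨y, hy⟩, map_zero]

/-- `κ(a) = 0 ⟹` at some level fixing `a`, `a` has `n`-th roots IN `A^{S i}` for every `n ≥ 1` (the invariant
compatible root system supplies them). [cite: LANA2026Report, §6.1 p.31] -/
theorem exists_roots_of_kummerMap_eq_zero (hc : IsExhausted A S) {a : A} (h0 : kummerMap hS hc a = 0) :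
    ∃ (i : ι), a ∈ invariants (A := A) (S i) ∧
      ∀ n : ℕ+, ∃ b ∈ invariants (A := A) (S i), b ^ (n : ℕ) = a := by
  obtain ⟨i, hi, y, hy⟩ := (kummerMap_eq_zero_iff S hS hc a).mp h0
  exact ⟨i, hi, fun n => ⟨y.root n, fun γ => hy n γ, y.pow_self n⟩⟩

/-- **Injectivity criterion for `κ : A → lim_{→} H¹(S i, Λ(A))`**: if at every level `S i` an `S i`-invariant
element with `n`-th roots in `A^{S i}` for all `n ≥ 1` is trivial (`⋂_n (A^{S i})^n = 1`, [AbsTopIII] Def. 1.5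
(a) level-wise), then the Kummer map is injective. [cite: LANA2026Report, §6.1 pp. 31–32] -/
theorem kummerMapHom_injective_of (hc : IsExhausted A S)
    (h : ∀ (i : ι) (a : A), a ∈ invariants (A := A) (S i) →
      (∀ n : ℕ+, ∃ b ∈ invariants (A := A) (S i), b ^ (n : ℕ) = a) → a = 1) :
    Function.Injective (kummerMapHom hS hc) := by
  refine (injective_iff_map_eq_zero _).2 fun x hx => ?_
  obtain ⟨i, hi, hroots⟩ := exists_roots_of_kummerMap_eq_zero S hS hc (a := x.toMul) hx
  have h1 : x.toMul = 1 := h i _ hi hroots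
  rw [← ofMul_toMul x, h1, ofMul_one]

end Kernel

end Literature.AnabelianGeometry.EtaleTheta

end
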